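import Summits.QuantumFields.YangMills.Theorems.BalabanUVNodesN11ThmP245OfSect3SupplyCoPH

/-!
# DAG node N11 — [III]'s p. 244 ASSUMPTION ON 𝐑 AS THE EXPLICIT 𝐑-SIDE HYPOTHESIS OBJECT OF THE SUPPLY-KEYED REDUCTION: THEOREM 1 OF [III], `densitiesDescribed`,
# `Dag.B14_main` AND `B16.Thm1Printed` AT A GENERIC v1.7 PARAMETER `θ` FROM EXACTLY THE TWO PER-LEVEL DELIVERABLES `NoExpansionTStepAt θ p k` ∕ `Sect3SupplyAt θ p k` AND THE
# p. 244 OBJECT OF RECORD `ROpLeaf (VOfRecord₁₃CoPH θ p)` (= `B14.RAssumedP244 …` by `Iff.rfl`; = the node's OWN antecedent `(leavesP w p).rOperation` under the carrier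
# binding) — NO live-selector clause, NO admissibility, NO `κ` sign; plus the LEVEL-PREFIX induction (Theorem 1 up to a level `n` from the deliverables and the 𝐑-steps BELOW `n`)

HEADER — WORK-UNIT METADATA.  Cell `pub-ymgap`, YM-PLAN Track A (HUMAN RULING D-0062 ∕ D-0149 width seats), seat `pub-ymgap-dag-n11-w3` (g0; WIDTH SEAT 3∕4 on NODE n11 [B14],
director-ym №197), route `BalabanUVNodes` (v1.7 `CoPH` key), item K1⁷ `StabilityBAtRecordR13SepCoPH` = stmt-QuantumFields-20542 (helper lane `--kind proof --supports 20542 --as helper`,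
count-neutral).  W-SEAT-START-LIST v3 §N11 ITEM 3: «𝐑 ASSUMED p.244 L36–38: the EXPLICIT hypothesis object (what [B14] assumes of 𝐑 from [B15]) typed once as a named Prop at the record
and consumed by n11-e's reduction (dedup with `…Sect3SupplyDefs` first)».  [III] = [Balaban1988Convergent], [IV] = [Balaban1989LargeFieldI], [B16] = [Balaban1989LargeFieldII].
Over dag-n11-e's `…ThmP245OfSect3SupplyCoPH` (p578897; §1 `tLaw₁₃CoPH_of_sLaw₁₃CoPH_of_tStep_of_supply`, §2 `thmP245Laws_of_tStep_of_supply`, §6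
`noExpansionTStepAt_rePinH_doorCured_theta13LiveOfRecord_zero`), `…Sect3SupplyDefs` (p576857), `…B16RLeafRecord13LiveCoPH` (p540794; `sLaw₁₃CoPH_all_of_laws`,
`densitiesDescribed_leavesP_iff_sLaw₁₃CoPH_all`, `densitiesDescribed_at_record₁₃CoPH_of_laws`, `b14_main_at_record₁₃CoPH_of_rOpLeaf`, `laws₁₃CoPH_theta13LiveOfRecord`),
`…B14NodeKnitRecord13RCoPH` (p543669; `rOpLeaf₁₃CoPH_iff_rAssumedP244`, `rOperation_iff_rOpLeaf₁₃CoPH`) and node00-def-T's `Node00/Record13CoPH` (`sLaw₁₃CoPH_zero`, `rOpLeaf_VOfRecord₁₃CoPH_iff`,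
`thm1Printed_datumOfRecord₁₃CoPH_of_tLaw_rOpLeaf`).

DEDUP RESULT (the item says «dedup first»).  [III] p. 244 lines 36–38, verbatim: *«The operation 𝐑 serves this purpose. We will not describe it here, we will only assume that it has
some properties incorporated in the inductive description of the effective actions.»*  The NAMED PROP EXISTS — twice — and is NOT re-declared here: (a) the sentence itself,
`B14.RAssumedP244 R Scorr S K := ∀ k < K, ∀ ρ′, Scorr (k+1) ρ′ → S (k+1) (R k ρ′)` (`Lit/…/B14.lean`); (b) AT THE v1.7 RECORD, `DagBinding.ROpLeaf (VOfRecord₁₃CoPH F N θ p)` —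
def-T's 𝐑-carriers of the run (`S j ρ :↔ ρ = ρ_j ∧ SLaw₁₃CoPH θ p j`, `Scorr (k+1) ρ′ :↔ ρ′ = 𝐓ρ_k ∧ TLaw₁₃CoPH θ p k`, `R k := 𝐓ρ_k ↦ ρ_{k+1}`) — which IS (a) at those carriers by
`Iff.rfl` (`rOpLeaf₁₃CoPH_iff_rAssumedP244`) and whose law form is `∀ k < K, TLaw₁₃CoPH θ p k → SLaw₁₃CoPH θ p (k+1)` (`rOpLeaf_VOfRecord₁₃CoPH_iff`): «𝐑 takes the 𝐓-image form
(the corresponding assumptions, p. 262 ∕ p. 279) to the §2 form with index `k+1`» — exactly what [III] assumes of 𝐑 from [IV]∕[B16], level by level.  `…Sect3SupplyDefs` names only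
`truncAbove`, `Sect3SupplyAt`, `NoExpansionTStepAt`.

WHY THIS FILE.  dag-n11-e's supply-keyed reduction (p578897) proves N11's (S1ᵀ) slot from the two per-level deliverables and then runs THE 𝐑-SIDE OF EVERY NODE FACE ON THE
LIVE-SELECTOR LINE: `sLaw₁₃CoPH_all_… ∕ densitiesDescribed_… ∕ b14_main_… ∕ thm1Printed_…_of_liveSel` take row `rstep` of `Provisos₁₃CoPH`, the selector clause `hsel`, admissibility
and the signs `0 ≤ κ, E₀, B₀` — i.e. the 𝐑 OF RECORD (which integrates out only dead sequences) — and none of them displays [III]'s p. 244 assumption itself.  This file is the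
other reading, the one print has: the 𝐑-side enters as THE ONE DISPLAYED OBJECT `ROpLeaf (VOfRecord₁₃CoPH θ p)` (N13's product BY NAME — `rOpLeaf₁₃CoPH_of_b16_main`), or in
[III]'s own name `B14.RAssumedP244 …`, or — at a world bound to the record in its carriers too — as the node's OWN in-edge `(leavesP w p).rOperation`; generic `θ`, no selector
clause, no admissibility, no `κ`.  And since the p. 245 induction consumes the assumption ONE LEVEL AT A TIME, §1 records the LEVEL-PREFIX form: `SLaw₁₃CoPH θ p k` for all
`k ≤ n` from the deliverables and the 𝐑-steps `TLaw_k → SLaw_{k+1}` at the levels `k < n` ONLY (no `K`, no proviso) — the shape in which «N11's slot closes level by level» (§4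
instantiates it at the re-pinned door of the cured witness of record, where the 𝐑-steps and the level-0 no-expansion 𝐓-step are theorems: Theorem 1 up to level `n ≤ K` from
[III] §3's supply below `n` and the no-expansion 𝐓-steps at the levels `1 … n−1` — p578897 §6 is the case `n = 1`).

WHAT THIS FILE PROVES (0 `def`, 0 `sorry`, standard axioms; every proof a composition of the tree theorems named above).
§1 PREFIX (generic `θ`; `1 ≤ M`, `0 ≤ B₀, E₀`): `sLaw₁₃CoPH_succ_of_tStep_of_supply_of_rStep` (one level of the p. 245 ∕ p. 244 induction, the 𝐑-step displayed) ·
   ★ `sLaw₁₃CoPH_le_of_tStep_of_supply_of_rStep_below` · `tLaw₁₃CoPH_lt_of_tStep_of_supply_of_rStep_below`.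
§2 ALL LEVELS, THE p. 244 OBJECT CONSUMED (generic `θ`): ★★ `sLaw₁₃CoPH_all_of_tStep_of_supply_of_rOpLeaf` (THEOREM 1 OF [III]: `∀ k ≤ K, SLaw₁₃CoPH θ p k`) ·
   `sLaw₁₃CoPH_all_of_tStep_of_supply_of_rAssumedP244` ([III]'s own name) · `tLaw₁₃CoPH_all_of_tStep_of_supply_of_rOpLeaf`.
§3 NODE FACES: ★ `densitiesDescribed_of_tStep_of_supply_of_rOpLeaf_core` (PROVISO-FREE: any world with `w.C = (coreOfRecord₁₃CoPH θ).construction (densOfRecord₁₃ …)`) ·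
   `densitiesDescribed_of_tStep_of_supply_of_rOpLeaf` (CoPH-datum world) · ★★ `b14_main_of_tStep_of_supply_of_up` (N11's DAG NODE `Dag.B14_main (leavesP w p)` at a world bound to
   the record in `hC` AND `hup`, THE 𝐑-ANTECEDENT READ FROM THE NODE'S OWN IN-EDGE — the two per-level deliverables and NOTHING on the 𝐑-side) · `b14_main_of_tStep_of_supply_of_rOpLeaf` ·
   ★ `thm1Printed_datumOfRecord₁₃CoPH_of_tStep_of_supply_of_rOpLeaf` (`B16.Thm1Printed` at the CoPH datum, windowed runs) · `…_of_rAssumedP244` · `thm1Printed_datumOfRecord₁₃SepCoPH_of_tStep_of_supply_of_rOpLeaf`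
   (the K1⁷ item's `SepCoPH` datum, `h.toCore` by `rfl`).
§4 A6 ∕ WHERE THE OBJECT IS INHABITED: the p. 244 object HOLDS on the live-selector line (n11-e `rOpLeaf_VOfRecord₁₃CoPH_of_liveSel_of_rstep`, cited — so p578897 §2–§3 are §2–§3 here
   ∘ that theorem) and at every H-extension of the witness of record with ZERO hypotheses (`rOpLeaf_VOfRecord₁₃CoPH_theta13LiveOfRecord`); instantiated: ★★
   `sLaw₁₃CoPH_le_theta13LiveOfRecordH_of_tStep_of_supply_below` (Theorem 1 UP TO LEVEL `n ≤ K` at any H-extension of the witness of record from the two deliverables BELOW `n` only) ·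
   ★★★ `sLaw₁₃CoPH_le_rePinH_doorCured_theta13LiveOfRecord_of_tStep_of_supply_below` (at the re-pinned door of K0a's cured witness of record: from [III] §3's supply at the levels
   `< n` and the no-expansion 𝐓-steps at the levels `1 ≤ k < n` — NOTHING ELSE; `n = 1` is p578897's `sLaw₁₃CoPH_one_rePinH_doorCured_theta13LiveOfRecord_of_sect3Supply_zero`).

HONEST FRAMING.  Count-neutral kernel bookkeeping: pure compositions; [III]'s p. 244 assumption (N13's product, [B16] Thm 1 — NOT exercised), [III] §3's supply and dag-n11-d's
no-expansion 𝐓-step are DISPLAYED hypotheses, discharged nowhere in this file (except where the tree already holds them: the 𝐑-steps and the level-0 𝐓-step at the witness of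
record); nothing of Bałaban's analysis asserted; N11 NOT discharged; K1⁷ NOT closed; counts unmoved (typed 28∕28 · discharged 5∕27).  One finite `𝕋⁴_{L^K}` programme at fixed
`ε = L^{−K}`; R4 would close the conditional finite-𝕋⁴ rung `BalabanLadder.UV` only — NOT ℝ⁴, NOT OS, NOT a mass gap, NOT Clay.  No `sorry`, no `axiom`, no `instance`, no `notation`.
Sources: [III] p.244 L36–38, Theorem p.245, Thm 1 p.262 + remarks p.262, p.279, (3.24)–(3.25) p.270, (2.17)–(2.18) p.257; [IV] (0.2)–(0.4) p.176, p.177 (i)–(ii); [B16] Thm 1 p.355.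
-/

noncomputable section

open MeasureTheory
open scoped BigOperators Matrix.Norms.L2Operator

namespace Summit.QuantumFields.YangMills.Theorems.BalabanUVNodesN11ThmP245OfSect3SupplyRAssumedCoPH

open Literature.MathematicalPhysics.QuantumFieldTheory.Balaban1983to89 T4Continuum Node00 Node00.Tk DagBinding
open Literature.MathematicalPhysics.QuantumFieldTheory.Balaban1983to89.B16RLeafRecord13LiveCoPH (sLaw₁₃CoPH_all_of_laws densitiesDescribed_leavesP_iff_sLaw₁₃CoPH_all
  densitiesDescribed_at_record₁₃CoPH_of_laws b14_main_at_record₁₃CoPH_of_rOpLeaf laws₁₃CoPH_theta13LiveOfRecord rOpLeaf_VOfRecord₁₃CoPH_theta13LiveOfRecord)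
open Literature.MathematicalPhysics.QuantumFieldTheory.Balaban1983to89.B16RLeafRecord13AtLive (B0_nonneg_theta13LiveOfFamily E0_nonneg_theta13LiveOfFamily)
open Literature.MathematicalPhysics.QuantumFieldTheory.Balaban1983to89.B14NodeKnitRecord13RCoPH (rOpLeaf₁₃CoPH_iff_rAssumedP244 rOperation_iff_rOpLeaf₁₃CoPH)
open BalabanUVNodesN11Sect3SupplyDefs
open BalabanUVNodesN11RePinnedParamDefs (rePinH)
open BalabanUVNodesN11ThmP245OfSect3SupplyCoPH (tLaw₁₃CoPH_of_sLaw₁₃CoPH_of_tStep_of_supply thmP245Laws_of_tStep_of_supply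
  noExpansionTStepAt_rePinH_doorCured_theta13LiveOfRecord_zero)

variable {F : T4Family} {N : ℕ} [NeZero N]
variable (θ : Stage13HParams F N) (p : B12.RunParams)

/-! ## §1. The level-prefix form of the p. 245 ∕ p. 244 induction: Theorem 1 up to a level `n` from the deliverables and the 𝐑-steps BELOW `n` -/

section Prefix

/-- **ONE LEVEL OF THEOREM 1's INDUCTION WITH THE 𝐑-STEP DISPLAYED** ([III] Thm 1 p. 262 along (0.2): the Theorem of p. 245 at level `k` — here from `SLaw₁₃CoPH θ p k` and the two
per-level deliverables, dag-n11-e's `tLaw₁₃CoPH_of_sLaw₁₃CoPH_of_tStep_of_supply` — followed by what p. 244 assumes of 𝐑 at that level, `TLaw₁₃CoPH θ p k → SLaw₁₃CoPH θ p (k+1)`).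
Generic `θ`; `1 ≤ M`, `0 ≤ B₀, E₀`; no `K`. [cite: Balaban1988Convergent, Thm 1 p.262, Theorem p.245, p.244 L36–38, p.279, (3.24)–(3.25) p.270] -/
theorem sLaw₁₃CoPH_succ_of_tStep_of_supply_of_rStep {k : ℕ} (hM : 1 ≤ θ.τ9.M) (hB₀ : 0 ≤ θ.s2.lf.B₀) (hE₀ : 0 ≤ θ.s2.lf.E₀)
    (hS : SLaw₁₃CoPH F N θ p k) (hT : NoExpansionTStepAt θ p k) (hsup : Sect3SupplyAt θ p k)
    (hR : TLaw₁₃CoPH F N θ p k → SLaw₁₃CoPH F N θ p (k + 1)) : SLaw₁₃CoPH F N θ p (k + 1) :=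
  hR (tLaw₁₃CoPH_of_sLaw₁₃CoPH_of_tStep_of_supply θ p hM hB₀ hE₀ hS hT hsup)

/-- **★ THEOREM 1 UP TO LEVEL `n` FROM THE DELIVERABLES AND THE 𝐑-STEPS BELOW `n` ONLY** (the prefix form of [III] Thm 1's induction, start `Node00.sLaw₁₃CoPH_zero`): for every
`k ≤ n`, `SLaw₁₃CoPH θ p k`, from `NoExpansionTStepAt θ p k`, `Sect3SupplyAt θ p k` and the p. 244 step `TLaw₁₃CoPH θ p k → SLaw₁₃CoPH θ p (k+1)` at the levels `k < n`.  Generic `θ`;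
no `K`, no proviso, no selector clause. [cite: Balaban1988Convergent, Thm 1 p.262, Theorem p.245, p.244 L36–38, (0.2) p.244] -/
theorem sLaw₁₃CoPH_le_of_tStep_of_supply_of_rStep_below (hM : 1 ≤ θ.τ9.M) (hB₀ : 0 ≤ θ.s2.lf.B₀) (hE₀ : 0 ≤ θ.s2.lf.E₀) {n : ℕ}
    (hT : ∀ k, k < n → NoExpansionTStepAt θ p k) (hsup : ∀ k, k < n → Sect3SupplyAt θ p k)
    (hR : ∀ k, k < n → TLaw₁₃CoPH F N θ p k → SLaw₁₃CoPH F N θ p (k + 1)) :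
    ∀ k, k ≤ n → SLaw₁₃CoPH F N θ p k := by
  intro k
  induction k with
  | zero => exact fun _ => sLaw₁₃CoPH_zero F N θ p
  | succ m ih =>
    exact fun hk => sLaw₁₃CoPH_succ_of_tStep_of_supply_of_rStep θ p hM hB₀ hE₀ (ih (Nat.le_of_succ_le hk)) (hT m (Nat.lt_of_succ_le hk))
      (hsup m (Nat.lt_of_succ_le hk)) (hR m (Nat.lt_of_succ_le hk))

/-- **… and the 𝐓-image laws at every level below `n`** (the (S1ᵀ) conclusion `TLaw₁₃CoPH θ p k`, `k < n`, along the prefix). [cite: Balaban1988Convergent, Theorem p.245, Thm 1 p.262, p.244 L36–38] -/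
theorem tLaw₁₃CoPH_lt_of_tStep_of_supply_of_rStep_below (hM : 1 ≤ θ.τ9.M) (hB₀ : 0 ≤ θ.s2.lf.B₀) (hE₀ : 0 ≤ θ.s2.lf.E₀) {n : ℕ}
    (hT : ∀ k, k < n → NoExpansionTStepAt θ p k) (hsup : ∀ k, k < n → Sect3SupplyAt θ p k)
    (hR : ∀ k, k < n → TLaw₁₃CoPH F N θ p k → SLaw₁₃CoPH F N θ p (k + 1)) :
    ∀ k, k < n → TLaw₁₃CoPH F N θ p k :=
  fun k hk => tLaw₁₃CoPH_of_sLaw₁₃CoPH_of_tStep_of_supply θ p hM hB₀ hE₀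
    (sLaw₁₃CoPH_le_of_tStep_of_supply_of_rStep_below θ p hM hB₀ hE₀ hT hsup hR k hk.le) (hT k hk) (hsup k hk)

end Prefix

/-! ## §2. All levels: THEOREM 1 OF [III] from the two per-level deliverables and the p. 244 object of record `ROpLeaf (VOfRecord₁₃CoPH θ p)` -/

section AllLevels

/-- **★★ THEOREM 1 OF [III] AT `θ`, ALL LEVELS, ALL HISTORIES — `∀ k ≤ K, SLaw₁₃CoPH θ p k` — FROM THE TWO PER-LEVEL DELIVERABLES AND [III]'s p. 244 ASSUMPTION AT THE RECORD**
(`hR : ROpLeaf (VOfRecord₁₃CoPH θ p)`, node N13's product by name; law form `∀ k < K, TLaw_k → SLaw_{k+1}` by def-T's `rOpLeaf_VOfRecord₁₃CoPH_iff`; the induction is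
`…LiveCoPH.sLaw₁₃CoPH_all_of_laws`, the (S1ᵀ) slot is dag-n11-e's `thmP245Laws_of_tStep_of_supply`).  Generic `θ`: NO selector clause, NO admissibility, NO `κ` sign.
[cite: Balaban1988Convergent, Thm 1 p.262, Theorem p.245, p.244 L36–38, remark p.262; Balaban1989LargeFieldII, Thm 1 p.355 (the assumption's source, not exercised)] -/
theorem sLaw₁₃CoPH_all_of_tStep_of_supply_of_rOpLeaf (hM : 1 ≤ θ.τ9.M) (hB₀ : 0 ≤ θ.s2.lf.B₀) (hE₀ : 0 ≤ θ.s2.lf.E₀)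
    (hT : ∀ k, k < p.K → NoExpansionTStepAt θ p k) (hsup : ∀ k, k < p.K → Sect3SupplyAt θ p k) (hR : ROpLeaf (VOfRecord₁₃CoPH F N θ p)) :
    ∀ k, k ≤ p.K → SLaw₁₃CoPH F N θ p k :=
  sLaw₁₃CoPH_all_of_laws F N θ p ((rOpLeaf_VOfRecord₁₃CoPH_iff F N θ p).1 hR) (thmP245Laws_of_tStep_of_supply θ p hM hB₀ hE₀ hT hsup)

/-- **THEOREM 1 OF [III] AT `θ` FROM THE TWO DELIVERABLES AND THE p. 244 SENTENCE IN [III]'s OWN NAME** — `B14.RAssumedP244` at the 𝐑-carriers of record (`Iff.rfl` with the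
leaf, `rOpLeaf₁₃CoPH_iff_rAssumedP244`). [cite: Balaban1988Convergent, p.244 L36–38, Thm 1 p.262, Theorem p.245] -/
theorem sLaw₁₃CoPH_all_of_tStep_of_supply_of_rAssumedP244 (hM : 1 ≤ θ.τ9.M) (hB₀ : 0 ≤ θ.s2.lf.B₀) (hE₀ : 0 ≤ θ.s2.lf.E₀)
    (hT : ∀ k, k < p.K → NoExpansionTStepAt θ p k) (hsup : ∀ k, k < p.K → Sect3SupplyAt θ p k)
    (hR : B14.RAssumedP244 (VOfRecord₁₃CoPH F N θ p).R (VOfRecord₁₃CoPH F N θ p).Scorr (VOfRecord₁₃CoPH F N θ p).S p.K) :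
    ∀ k, k ≤ p.K → SLaw₁₃CoPH F N θ p k :=
  sLaw₁₃CoPH_all_of_tStep_of_supply_of_rOpLeaf θ p hM hB₀ hE₀ hT hsup ((rOpLeaf₁₃CoPH_iff_rAssumedP244 F N θ p).2 hR)

/-- **… hence the 𝐓-image laws at EVERY level `k < K`** (the (S1ᵀ) conclusion all along the run). [cite: Balaban1988Convergent, Theorem p.245, Thm 1 p.262, p.244 L36–38] -/
theorem tLaw₁₃CoPH_all_of_tStep_of_supply_of_rOpLeaf (hM : 1 ≤ θ.τ9.M) (hB₀ : 0 ≤ θ.s2.lf.B₀) (hE₀ : 0 ≤ θ.s2.lf.E₀)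
    (hT : ∀ k, k < p.K → NoExpansionTStepAt θ p k) (hsup : ∀ k, k < p.K → Sect3SupplyAt θ p k) (hR : ROpLeaf (VOfRecord₁₃CoPH F N θ p)) :
    ∀ k, k < p.K → TLaw₁₃CoPH F N θ p k :=
  fun k hk => thmP245Laws_of_tStep_of_supply θ p hM hB₀ hE₀ hT hsup k hk
    (sLaw₁₃CoPH_all_of_tStep_of_supply_of_rOpLeaf θ p hM hB₀ hE₀ hT hsup hR k hk.le)

end AllLevels

/-! ## §3. The node faces with the p. 244 object displayed: `densitiesDescribed`, `Dag.B14_main` (𝐑 from the node's OWN in-edge), `B16.Thm1Printed` -/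

section Node

/-- **★ N11's NODE SENTENCE `densitiesDescribed` — PROVISO-FREE — at ANY world whose C-binding is the CoPH core's construction over the densities of record** (the key of
`…LiveCoPH.densitiesDescribed_leavesP_iff_sLaw₁₃CoPH_all`), from the two per-level deliverables and the p. 244 object.  Generic `θ`; no `Provisos₁₃CoPH`, no selector clause.
[cite: Balaban1988Convergent, Thm 1 p.262, Theorem p.245, p.244 L36–38] -/
theorem densitiesDescribed_of_tStep_of_supply_of_rOpLeaf_core (hM : 1 ≤ θ.τ9.M) (hB₀ : 0 ≤ θ.s2.lf.B₀) (hE₀ : 0 ≤ θ.s2.lf.E₀)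
    (hT : ∀ k, k < p.K → NoExpansionTStepAt θ p k) (hsup : ∀ k, k < p.K → Sect3SupplyAt θ p k) (hR : ROpLeaf (VOfRecord₁₃CoPH F N θ p))
    (w : WorldP) (hC : w.C = (coreOfRecord₁₃CoPH F N θ).construction (densOfRecord₁₃ F N θ.toStage13Params)) :
    (leavesP w p).densitiesDescribed :=
  (densitiesDescribed_leavesP_iff_sLaw₁₃CoPH_all F N θ p w hC).2 (sLaw₁₃CoPH_all_of_tStep_of_supply_of_rOpLeaf θ p hM hB₀ hE₀ hT hsup hR)

/-- **N11's NODE SENTENCE `densitiesDescribed` AT A WORLD BOUND TO THE CoPH DATUM OF `θ`** (`w.C = (datumOfRecord₁₃CoPH θ h).C`), from the two per-level deliverables and the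
p. 244 object (`…LiveCoPH.densitiesDescribed_at_record₁₃CoPH_of_laws`).  `h` is only the datum's key. [cite: Balaban1988Convergent, Thm 1 p.262, Theorem p.245, p.244 L36–38] -/
theorem densitiesDescribed_of_tStep_of_supply_of_rOpLeaf (h : θ.Provisos₁₃CoPH F N) (hM : 1 ≤ θ.τ9.M) (hB₀ : 0 ≤ θ.s2.lf.B₀) (hE₀ : 0 ≤ θ.s2.lf.E₀)
    (hT : ∀ k, k < p.K → NoExpansionTStepAt θ p k) (hsup : ∀ k, k < p.K → Sect3SupplyAt θ p k) (hR : ROpLeaf (VOfRecord₁₃CoPH F N θ p))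
    (w : WorldP) (hC : w.C = (datumOfRecord₁₃CoPH F N θ h).C) :
    (leavesP w p).densitiesDescribed :=
  densitiesDescribed_at_record₁₃CoPH_of_laws F N θ p w h hC ((rOpLeaf_VOfRecord₁₃CoPH_iff F N θ p).1 hR) (thmP245Laws_of_tStep_of_supply θ p hM hB₀ hE₀ hT hsup)

/-- **★★ N11's DAG NODE `Dag.B14_main (leavesP w p)` AT A WORLD BOUND TO THE RECORD IN ITS C-BINDING AND ITS CARRIERS, THE 𝐑-ANTECEDENT READ FROM THE NODE'S OWN IN-EDGE**:
at `w.C = (datumOfRecord₁₃CoPH θ h).C` and `w.up p = upOfRecord₅C (θ.toStage5₁₃CoPH) p` the node's hypothesis `(leavesP w p).rOperation` IS `ROpLeaf (VOfRecord₁₃CoPH θ p)`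
(`rOperation_iff_rOpLeaf₁₃CoPH`, `Iff.rfl` behind the binding) — what [III] p. 244 assumes of 𝐑 — so the node follows from the two per-level deliverables with NOTHING supplied on
the 𝐑-side (`…LiveCoPH.b14_main_at_record₁₃CoPH_of_rOpLeaf`; the other in-edges `b7 … b11`, `smallCouplings`, `smallFieldInductive`, `flowControl` are not read).
[cite: Balaban1988Convergent, Thm 1 p.262, Theorem p.245, p.244 L36–38; Balaban1989LargeFieldII, Thm 1 p.355 (the in-edge's source)] -/
theorem b14_main_of_tStep_of_supply_of_up (h : θ.Provisos₁₃CoPH F N) (hM : 1 ≤ θ.τ9.M) (hB₀ : 0 ≤ θ.s2.lf.B₀) (hE₀ : 0 ≤ θ.s2.lf.E₀)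
    (hT : ∀ k, k < p.K → NoExpansionTStepAt θ p k) (hsup : ∀ k, k < p.K → Sect3SupplyAt θ p k)
    (w : WorldP) (hC : w.C = (datumOfRecord₁₃CoPH F N θ h).C) (hup : w.up p = upOfRecord₅C F N (θ.toStage5₁₃CoPH F N) p) :
    Dag.B14_main (leavesP w p) :=
  b14_main_at_record₁₃CoPH_of_rOpLeaf F N θ p w h hC (fun hrop => (rOperation_iff_rOpLeaf₁₃CoPH F N θ w p hup).1 hrop)
    (fun _ _ _ _ _ _ _ _ => thmP245Laws_of_tStep_of_supply θ p hM hB₀ hE₀ hT hsup)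

/-- **N11's DAG NODE `Dag.B14_main (leavesP w p)` AT A WORLD BOUND TO THE CoPH DATUM, the p. 244 object displayed** (`hR : ROpLeaf (VOfRecord₁₃CoPH θ p)` instead of the carrier
binding). [cite: Balaban1988Convergent, Thm 1 p.262, Theorem p.245, p.244 L36–38] -/
theorem b14_main_of_tStep_of_supply_of_rOpLeaf (h : θ.Provisos₁₃CoPH F N) (hM : 1 ≤ θ.τ9.M) (hB₀ : 0 ≤ θ.s2.lf.B₀) (hE₀ : 0 ≤ θ.s2.lf.E₀)
    (hT : ∀ k, k < p.K → NoExpansionTStepAt θ p k) (hsup : ∀ k, k < p.K → Sect3SupplyAt θ p k) (hR : ROpLeaf (VOfRecord₁₃CoPH F N θ p))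
    (w : WorldP) (hC : w.C = (datumOfRecord₁₃CoPH F N θ h).C) :
    Dag.B14_main (leavesP w p) :=
  b14_main_at_record₁₃CoPH_of_rOpLeaf F N θ p w h hC (fun _ => hR) (fun _ _ _ _ _ _ _ _ => thmP245Laws_of_tStep_of_supply θ p hM hB₀ hE₀ hT hsup)

/-- **★ `B16.Thm1Printed (datumOfRecord₁₃CoPH θ h).C` — [III] THEOREM 1 AT THE CoPH DATUM OF `θ` (the route's (B)-face first conjunct) FROM THE TWO PER-LEVEL DELIVERABLES AND THE
p. 244 OBJECT ALONG EVERY WINDOWED RUN** (def-T's `thm1Printed_datumOfRecord₁₃CoPH_of_tLaw_rOpLeaf`: (S1ᵀ) by dag-n11-e's `thmP245Laws_of_tStep_of_supply`, the leaf DISPLAYED per run).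
Generic `θ`; `h` is only the datum's key. [cite: Balaban1988Convergent, Thm 1 p.262, Theorem p.245, p.244 L36–38; Balaban1989LargeFieldII, Thm 1 p.355 (not exercised)] -/
theorem thm1Printed_datumOfRecord₁₃CoPH_of_tStep_of_supply_of_rOpLeaf (h : θ.Provisos₁₃CoPH F N) (hM : 1 ≤ θ.τ9.M) (hB₀ : 0 ≤ θ.s2.lf.B₀) (hE₀ : 0 ≤ θ.s2.lf.E₀)
    {γ : ℝ} (hγ : 0 < γ)
    (hT : ∀ P : B12.RunParams, ((datumOfRecord₁₃CoPH F N θ h).C P).flow.InInterval γ P.K → ∀ k, k < P.K → NoExpansionTStepAt θ P k)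
    (hsup : ∀ P : B12.RunParams, ((datumOfRecord₁₃CoPH F N θ h).C P).flow.InInterval γ P.K → ∀ k, k < P.K → Sect3SupplyAt θ P k)
    (hR : ∀ P : B12.RunParams, ((datumOfRecord₁₃CoPH F N θ h).C P).flow.InInterval γ P.K → ROpLeaf (VOfRecord₁₃CoPH F N θ P)) :
    B16.Thm1Printed (datumOfRecord₁₃CoPH F N θ h).C :=
  thm1Printed_datumOfRecord₁₃CoPH_of_tLaw_rOpLeaf F N θ h hγ (fun P hP => thmP245Laws_of_tStep_of_supply θ P hM hB₀ hE₀ (hT P hP) (hsup P hP)) hR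

/-- **`B16.Thm1Printed` AT THE CoPH DATUM FROM THE TWO DELIVERABLES AND THE p. 244 SENTENCE IN [III]'s OWN NAME** (`B14.RAssumedP244` at the 𝐑-carriers of record, per windowed run).
[cite: Balaban1988Convergent, p.244 L36–38, Thm 1 p.262, Theorem p.245; Balaban1989LargeFieldII, Thm 1 p.355 (not exercised)] -/
theorem thm1Printed_datumOfRecord₁₃CoPH_of_tStep_of_supply_of_rAssumedP244 (h : θ.Provisos₁₃CoPH F N) (hM : 1 ≤ θ.τ9.M) (hB₀ : 0 ≤ θ.s2.lf.B₀) (hE₀ : 0 ≤ θ.s2.lf.E₀)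
    {γ : ℝ} (hγ : 0 < γ)
    (hT : ∀ P : B12.RunParams, ((datumOfRecord₁₃CoPH F N θ h).C P).flow.InInterval γ P.K → ∀ k, k < P.K → NoExpansionTStepAt θ P k)
    (hsup : ∀ P : B12.RunParams, ((datumOfRecord₁₃CoPH F N θ h).C P).flow.InInterval γ P.K → ∀ k, k < P.K → Sect3SupplyAt θ P k)
    (hR : ∀ P : B12.RunParams, ((datumOfRecord₁₃CoPH F N θ h).C P).flow.InInterval γ P.K →
      B14.RAssumedP244 (VOfRecord₁₃CoPH F N θ P).R (VOfRecord₁₃CoPH F N θ P).Scorr (VOfRecord₁₃CoPH F N θ P).S P.K) :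
    B16.Thm1Printed (datumOfRecord₁₃CoPH F N θ h).C :=
  thm1Printed_datumOfRecord₁₃CoPH_of_tStep_of_supply_of_rOpLeaf θ h hM hB₀ hE₀ hγ hT hsup fun P hP => (rOpLeaf₁₃CoPH_iff_rAssumedP244 F N θ P).2 (hR P hP)

/-- **`B16.Thm1Printed` AT THE v1.7 SEPARATED-RANGE DATUM `datumOfRecord₁₃SepCoPH θ h`** (`h : Provisos₁₃SepCoPH`, the K1⁷ item's key; `= datumOfRecord₁₃CoPH θ h.toCore` by `rfl`) from
the two deliverables and the p. 244 object per windowed run. [cite: Balaban1988Convergent, p.244 L36–38, Thm 1 p.262, Theorem p.245; Balaban1989LargeFieldII, Thm 1 p.355 (not exercised)] -/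
theorem thm1Printed_datumOfRecord₁₃SepCoPH_of_tStep_of_supply_of_rOpLeaf (h : θ.Provisos₁₃SepCoPH F N) (hM : 1 ≤ θ.τ9.M) (hB₀ : 0 ≤ θ.s2.lf.B₀) (hE₀ : 0 ≤ θ.s2.lf.E₀)
    {γ : ℝ} (hγ : 0 < γ)
    (hT : ∀ P : B12.RunParams, ((datumOfRecord₁₃SepCoPH F N θ h).C P).flow.InInterval γ P.K → ∀ k, k < P.K → NoExpansionTStepAt θ P k)
    (hsup : ∀ P : B12.RunParams, ((datumOfRecord₁₃SepCoPH F N θ h).C P).flow.InInterval γ P.K → ∀ k, k < P.K → Sect3SupplyAt θ P k)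
    (hR : ∀ P : B12.RunParams, ((datumOfRecord₁₃SepCoPH F N θ h).C P).flow.InInterval γ P.K → ROpLeaf (VOfRecord₁₃CoPH F N θ P)) :
    B16.Thm1Printed (datumOfRecord₁₃SepCoPH F N θ h).C :=
  thm1Printed_datumOfRecord₁₃CoPH_of_tStep_of_supply_of_rOpLeaf θ h.toCore hM hB₀ hE₀ hγ hT hsup hR

end Node

/-! ## §4. A6 — the p. 244 object is inhabited where the tree says so; the prefix form at the witness of record and at the re-pinned door of its cured family -/

section Record

variable (F N)
variable (Zr : (q : B12.RunParams) → TkResidualW F N (FluctV N) q.K) (Zh : (q : B12.RunParams) → ℕ → (ℕ → Set (Site (F.P q.K) 0)) → (ℕ → Set (Site (F.P q.K) 0)) → TkResidualW F N (FluctV N) q.K)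
  (Phih : (q : B12.RunParams) → ℕ → (ℕ → Set (Site (F.P q.K) 0)) → (ℕ → Set (Site (F.P q.K) 0)) → (ℕ → Plaq (F.P q.K) 0 → ℝ))

/-- **★★ THEOREM 1 UP TO LEVEL `n ≤ K` AT ANY H-EXTENSION `⟨⟨θ₁₃, Zr⟩, Zh, Phih⟩` OF THE WITNESS OF RECORD `θ₁₃ = theta13LiveOfRecord F N` FROM THE TWO DELIVERABLES BELOW `n`
ONLY**: there the p. 244 object HOLDS with zero hypotheses (`…LiveCoPH.rOpLeaf_VOfRecord₁₃CoPH_theta13LiveOfRecord`; law form `laws₁₃CoPH_theta13LiveOfRecord`), `M = 1` and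
`0 ≤ B₀, E₀` are the family's numerals — so §1 reads: `∀ k ≤ n, SLaw₁₃CoPH … p k` from `NoExpansionTStepAt` ∕ `Sect3SupplyAt` at the levels `k < n`.  (`n = K` is p578897 §5.)
[cite: Balaban1988Convergent, Thm 1 p.262, Theorem p.245, p.244 L36–38, (3.24)–(3.25) p.270; Balaban1989LargeFieldI, (0.3)–(0.4) p.176, p.177 (i)–(ii)] -/
theorem sLaw₁₃CoPH_le_theta13LiveOfRecordH_of_tStep_of_supply_below {n : ℕ} (hn : n ≤ p.K)
    (hT : ∀ k, k < n → NoExpansionTStepAt (⟨⟨theta13LiveOfRecord F N, Zr⟩, Zh, Phih⟩ : Stage13HParams F N) p k)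
    (hsup : ∀ k, k < n → Sect3SupplyAt (⟨⟨theta13LiveOfRecord F N, Zr⟩, Zh, Phih⟩ : Stage13HParams F N) p k) :
    ∀ k, k ≤ n → SLaw₁₃CoPH F N (⟨⟨theta13LiveOfRecord F N, Zr⟩, Zh, Phih⟩ : Stage13HParams F N) p k :=
  sLaw₁₃CoPH_le_of_tStep_of_supply_of_rStep_below _ p (le_of_eq rfl)
    (B0_nonneg_theta13LiveOfFamily F N eps0OfRecord₁₃ (zeta316OfRecord F N (numerics7OfFamily eps0OfRecord₁₃) 1 1) (RzOfRecord F N) (ZtOfRecord F N))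
    (E0_nonneg_theta13LiveOfFamily F N eps0OfRecord₁₃ (zeta316OfRecord F N (numerics7OfFamily eps0OfRecord₁₃) 1 1) (RzOfRecord F N) (ZtOfRecord F N)) hT hsup
    fun k hk => laws₁₃CoPH_theta13LiveOfRecord F N Zr Zh Phih p k (lt_of_lt_of_le hk hn)

/-- **★★★ THEOREM 1 UP TO LEVEL `n ≤ K` AT THE RE-PINNED DOOR OF K0a's CURED WITNESS OF RECORD FROM [III] §3's SUPPLY AT THE LEVELS `< n` AND THE NO-EXPANSION 𝐓-STEPS AT THE
LEVELS `1 ≤ k < n` — NOTHING ELSE**: the door `rePinH (ofHistoryBlind (ofCured θ₁₃))` is such an H-extension (by `rfl`), and there the level-0 no-expansion 𝐓-step is dag-n11-e's THEOREM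
`noExpansionTStepAt_rePinH_doorCured_theta13LiveOfRecord_zero` (a no-expansion history of length 1 is the all-large-field one).  `n = 1`: no 𝐓-step hypothesis at all — p578897 §6's
`sLaw₁₃CoPH_one_rePinH_doorCured_theta13LiveOfRecord_of_sect3Supply_zero`. [cite: Balaban1988Convergent, Thm 1 p.262, Theorem p.245, p.244 L36–38, (3.24)–(3.25) p.270, (1.11) p.248; Balaban1989LargeFieldI, (0.3)–(0.4) p.176] -/
theorem sLaw₁₃CoPH_le_rePinH_doorCured_theta13LiveOfRecord_of_tStep_of_supply_below {n : ℕ} (hn : n ≤ p.K)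
    (hT : ∀ k, 0 < k → k < n → NoExpansionTStepAt (rePinH (Stage13HParams.ofHistoryBlind F N (Stage13RParams.ofCured F N (theta13LiveOfRecord F N)))) p k)
    (hsup : ∀ k, k < n → Sect3SupplyAt (rePinH (Stage13HParams.ofHistoryBlind F N (Stage13RParams.ofCured F N (theta13LiveOfRecord F N)))) p k) :
    ∀ k, k ≤ n → SLaw₁₃CoPH F N (rePinH (Stage13HParams.ofHistoryBlind F N (Stage13RParams.ofCured F N (theta13LiveOfRecord F N)))) p k :=
  sLaw₁₃CoPH_le_of_tStep_of_supply_of_rStep_below _ p (le_of_eq rfl)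
    (B0_nonneg_theta13LiveOfFamily F N eps0OfRecord₁₃ (zeta316OfRecord F N (numerics7OfFamily eps0OfRecord₁₃) 1 1) (RzOfRecord F N) (ZtOfRecord F N))
    (E0_nonneg_theta13LiveOfFamily F N eps0OfRecord₁₃ (zeta316OfRecord F N (numerics7OfFamily eps0OfRecord₁₃) 1 1) (RzOfRecord F N) (ZtOfRecord F N))
    (fun k hk => by
      rcases Nat.eq_zero_or_pos k with rfl | hk0
      · exact noExpansionTStepAt_rePinH_doorCured_theta13LiveOfRecord_zero F N p (lt_of_lt_of_le hk hn)
      · exact hT k hk0 hk)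
    hsup fun k hk => laws₁₃CoPH_theta13LiveOfRecord F N _ _ _ p k (lt_of_lt_of_le hk hn)

end Record

end Summit.QuantumFields.YangMills.Theorems.BalabanUVNodesN11ThmP245OfSect3SupplyRAssumedCoPH

end
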